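import Summits.NavierStokesRegularity.OSWSelfSimilar.SheetREnergyClass
import Summits.NavierStokesRegularity.OSWSelfSimilar.SheetRHilbertDerivL1
import Literature.Analysis.Fourier.HilbertTransformLineL2
import Literature.Analysis.Fourier.HilbertTransformLineMoment
import Mathlib.MeasureTheory.Integral.IntegralEqImproper
import HarnessLib

/-!
# SHEET-ℝ: regularity and a priori bounds of an energy-class strong zero of the profile map (`C³`, sup bounds,
# `HΩ → 0` at infinity, the differentiated equation)

HONEST FRAMING (cell ns-blowup GROUP B / zone Z3, case Z3-SR-SPEC item (P6b); 1-D MODEL — the viscous gCLM / OSW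
sheet-ℝ profile equation; not Euler, not NS; «violates: none — MODEL»). Nothing here asserts that a profile exists: every
statement is an implication from a strong zero.

SETTING. `Ω ∈ C²(ℝ)` is a pointwise zero of the certificate's profile map,
  `Ω(X) + ½X·Ω′(X) + a·𝒰Ω(X)·Ω′(X) − HΩ(X)·Ω(X) − ν·Ω″(X) = 0`,  `𝒰Ω(X) = ∫₀^X HΩ`,  `H = hilbertTransform`,
(the output of the tree's weak→strong bridge `SheetRWeakToStrong.contDiff_two_and_strongZero_of_weakZero`) and lies in the
certificate's energy class `E = H¹_{L²+ξ²}`: `∫(L²+ξ²)Ω² < ∞`, `∫(L²+ξ²)Ω′² < ∞` (`L > 0`); `Ω` odd where stated.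

CONTENTS (all kernel, pure calculus on the tree's p.v. operator):
* `basic` — `Ω, Ω′ ∈ L¹ ∩ L²`, `ξΩ, ξΩ′ ∈ L²`;
* `hilbert_basic` — `HΩ ∈ C¹` with `(HΩ)′ = H[Ω′]` (cert-5 g4 `SheetRHilbertDerivL1`, no pointwise decay), `HΩ, H[Ω′] ∈ L²`,
  `ξ·H[Ω′] ∈ L²` (moment formula with `∫Ω′ = 0` + the `L²` isometry without `L¹`, `eLpNorm_hilbertTransform_eq_of_memLp`);
* `exists_bounds` — `sup (1+ξ²)Ω² < ∞`, `sup |HΩ| < ∞`, `sup |𝒰Ω| < ∞` (Agmon on the energy class + the tree's velocity bound);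
* `hilbert_small` — `HΩ(ξ) → 0` as `|ξ| → ∞` (Mathlib `tendsto_zero_of_hasDerivAt_of_integrableOn_Ioi` on `(HΩ)²`);
* `contDiff_three` — `Ω ∈ C³` (`νΩ″ = F ∈ C¹`), `deriv_three_eq` — the differentiated equation
  `νΩ‴ = (½ξ + a𝒰Ω)Ω″ + (3/2 + (a−1)HΩ)Ω′ − H[Ω′]·Ω`, i.e. `Ψ = Ω′` solves the similarity ODE of
  `SheetRWeightedGain.weighted_gain` with `κ = 3/2`, `b = a𝒰Ω`, `c = (a−1)HΩ`, `g = −H[Ω′]Ω`;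
* `memLp_two_deriv_two` — `Ω″ ∈ L²` (level-0 start of the weighted gain).
These are inputs (i)–(v) of the (P6b) assembly («the T-shift mode `Ω + ½ξΩ′` lies in `E`»), completed in
`SheetRTimeShiftModeEnergy`. [folklore] 1-D calculus; MODEL-support, no NS content, no number of any certificate moves.
-/

noncomputable section

namespace Summit.NavierStokesRegularity.OSWSelfSimilar
namespace SheetRProfileRegularity

open _root_.MeasureTheory _root_.Set _root_.Filter Literature.Analysis.Fourier SheetRWeakProfilePV
  SheetRHilbertDerivL1
open scoped Real Topology ENNReal

variable {a ν L : ℝ} {Ω : ℝ → ℝ}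

/-! ### §1 `L¹`/`L²` bookkeeping on the energy class -/

/-- Primitive form of a `C¹` function: `Ω(x) = Ω(0) + ∫₀^x Ω′`. [folklore] -/
theorem eq_add_integral_deriv (hΩ : ContDiff ℝ 1 Ω) (x : ℝ) :
    Ω x = Ω 0 + ∫ s in (0 : ℝ)..x, deriv Ω s := by
  have hd : ∀ y, HasDerivAt Ω (deriv Ω y) y := fun y => ((hΩ.differentiable one_ne_zero) y).hasDerivAt
  have h := intervalIntegral.integral_eq_sub_of_hasDerivAt (fun y _ => hd y)
    ((hΩ.continuous_deriv le_rfl).intervalIntegrable 0 x)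
  linarith

/-- Agmon's inequality for a function with continuous square-integrable derivative: `f(x)² ≤ 2∫|f·f′|`. [folklore] -/
theorem sq_le_of_hasDerivAt {f f' : ℝ → ℝ} (hd : ∀ x, HasDerivAt f (f' x) x) (hc : Continuous f')
    (hf2 : MemLp f 2) (hf'2 : MemLp f' 2) (x : ℝ) : f x ^ 2 ≤ 2 * ∫ y, |f y * f' y| := by
  have hprim : ∀ y, f y = f 0 + ∫ s in (0 : ℝ)..y, f' s := fun y => by
    have h := intervalIntegral.integral_eq_sub_of_hasDerivAt (fun s _ => hd s) (hc.intervalIntegrable 0 y)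
    linarith
  exact SheetREnergyClass.sq_le_two_integral_abs_mul_of_primitive hprim hf'2 hf2 x

/-- A bounded continuous multiplier preserves `L²`. [folklore] -/
theorem memLp_two_bdd_mul {φ h : ℝ → ℝ} {C : ℝ} (hφ : Continuous φ) (hC : ∀ x, |φ x| ≤ C)
    (hh : MemLp h 2) : MemLp (fun x => φ x * h x) 2 := by
  have hφt : MemLp φ ∞ := memLp_top_of_bound hφ.aestronglyMeasurable C
    (Eventually.of_forall fun x => by rw [Real.norm_eq_abs]; exact hC x)
  exact hh.mul' hφt

/-- **Energy-class bookkeeping.** For `Ω ∈ C¹` with `∫(L²+y²)Ω² < ∞`, `∫(L²+y²)Ω′² < ∞` (`L > 0`):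
`Ω, Ω′ ∈ L¹ ∩ L²` and `y·Ω, y·Ω′ ∈ L²`. [folklore] -/
theorem basic (hL : 0 < L) (hΩ : ContDiff ℝ 1 Ω) (hw0 : Integrable fun y => (L ^ 2 + y ^ 2) * Ω y ^ 2)
    (hw1 : Integrable fun y => (L ^ 2 + y ^ 2) * deriv Ω y ^ 2) :
    Integrable Ω ∧ MemLp Ω 2 ∧ Integrable (deriv Ω) ∧ MemLp (deriv Ω) 2 ∧
      MemLp (fun y => y * Ω y) 2 ∧ MemLp (fun y => y * deriv Ω y) 2 := by
  have hprim := eq_add_integral_deriv hΩ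
  have hΩ'c : Continuous (deriv Ω) := hΩ.continuous_deriv le_rfl
  obtain ⟨-, hΩ'2, hΩ2, hΩi, hxΩ⟩ :=
    SheetREnergyClass.basic_of_primitive hL hprim hΩ'c.aestronglyMeasurable hw0 hw1
  have hΩ'i : Integrable (deriv Ω) :=
    SheetRWeightedEmbeddings.integrable_of_weighted_sq hL hΩ'c.aestronglyMeasurable hw1
  have hxΩ' : MemLp (fun y => y * deriv Ω y) 2 := by
    have hm : AEStronglyMeasurable (fun y => y * deriv Ω y) volume :=
      (continuous_id.mul hΩ'c).aestronglyMeasurable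
    rw [memLp_two_iff_integrable_sq hm]
    refine hw1.mono' (hm.pow 2) (Eventually.of_forall fun y => ?_)
    rw [Real.norm_eq_abs, abs_of_nonneg (sq_nonneg _)]
    nlinarith [sq_nonneg (deriv Ω y), sq_nonneg L, mul_nonneg (sq_nonneg L) (sq_nonneg (deriv Ω y))]
  exact ⟨hΩi, hΩ2, hΩ'i, hΩ'2, hxΩ, hxΩ'⟩

/-! ### §2 The Hilbert transform of an energy-class `C²` profile -/

/-- **`HΩ` on the energy class.** For `Ω ∈ C²` odd with `∫(L²+y²)Ω² < ∞`, `∫(L²+y²)Ω′² < ∞`: `HΩ ∈ C¹` with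
`(HΩ)′ = H[Ω′]` at every point (no pointwise decay: `SheetRHilbertDerivL1`), `HΩ ∈ L²`, `HΩ` is even, `H[Ω′]` is
continuous and square integrable, and `ξ·H[Ω′](ξ) ∈ L²` (moment formula `H[yΩ′] = ξ·H[Ω′]` from `∫Ω′ = 0`, and the
`L²` isometry of `H` on `yΩ′ ∈ L²` without an `L¹` hypothesis).
[cite: King2009HilbertTransforms2, eq. (19.270) and Appendix 1 Table 1.1 (1.20)] -/
theorem hilbert_basic (hL : 0 < L) (hΩ : ContDiff ℝ 2 Ω) (hodd : ∀ y, Ω (-y) = -Ω y)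
    (hw0 : Integrable fun y => (L ^ 2 + y ^ 2) * Ω y ^ 2)
    (hw1 : Integrable fun y => (L ^ 2 + y ^ 2) * deriv Ω y ^ 2) :
    ContDiff ℝ 1 (hilbertTransform Ω) ∧
      (∀ x, HasDerivAt (hilbertTransform Ω) (hilbertTransform (deriv Ω) x) x) ∧
      MemLp (hilbertTransform Ω) 2 ∧ (∀ y, hilbertTransform Ω (-y) = hilbertTransform Ω y) ∧
      Continuous (hilbertTransform (deriv Ω)) ∧ MemLp (hilbertTransform (deriv Ω)) 2 ∧
      MemLp (fun x => x * hilbertTransform (deriv Ω) x) 2 := by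
  have hΩ1 : ContDiff ℝ 1 Ω := hΩ.of_le (by norm_num)
  obtain ⟨hΩi, hΩ2, hΩ'i, hΩ'2, -, hxΩ'⟩ := basic hL hΩ1 hw0 hw1
  have hΩ'1 : ContDiff ℝ 1 (deriv Ω) := (contDiff_succ_iff_deriv.1 (hΩ : ContDiff ℝ (1 + 1) Ω)).2.2
  have hprim := eq_add_integral_deriv hΩ1
  have hH1 : ContDiff ℝ 1 (hilbertTransform Ω) := contDiff_one_hilbertTransform hΩ hΩi hΩ'i
  have hHd : ∀ x, HasDerivAt (hilbertTransform Ω) (hilbertTransform (deriv Ω) x) x :=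
    hasDerivAt_hilbertTransform_of_integrable_deriv hΩ hΩi hΩ'i
  have hH2 : MemLp (hilbertTransform Ω) 2 := (memLp_two_hilbertTransform_of_primitive hprim hΩ'2 hΩi hΩ2).1
  have hH'c : Continuous (hilbertTransform (deriv Ω)) := continuous_hilbertTransform_of_contDiff hΩ'1 hΩ'i
  have hH'2 : MemLp (hilbertTransform (deriv Ω)) 2 := (eLpNorm_hilbertTransform_eq_of_contDiff hΩ'1 hΩ'i hΩ'2).1
  -- `ξ·H[Ω′] = H[yΩ′]` pointwise, and `H[yΩ′] ∈ L²`
  have hd1 : ∀ y, HasDerivAt Ω (deriv Ω y) y := fun y => ((hΩ1.differentiable one_ne_zero) y).hasDerivAt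
  have hint0 : ∫ y, deriv Ω y = 0 := integral_eq_zero_of_hasDerivAt_of_integrable hd1 hΩ'i hΩi
  have hpv : ∀ x, IntegrableOn (fun t => (deriv Ω (x - t) - deriv Ω (x + t)) / t) (Ioi 0) :=
    fun x => integrableOn_symmIntegrand_of_contDiff hΩ'1 hΩ'i x
  have hpv' : ∀ x, IntegrableOn (fun t => ((x - t) * deriv Ω (x - t) - (x + t) * deriv Ω (x + t)) / t) (Ioi 0) :=
    fun x => integrableOn_symmIntegrand_id_mul hΩ'i (hpv x)
  have hpt : (fun x => x * hilbertTransform (deriv Ω) x) = hilbertTransform (fun y => y * deriv Ω y) := by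
    funext x
    exact (hilbertTransform_mul_id_of_integral_zero hΩ'i (hpv x) hint0).symm
  have hxH' : MemLp (fun x => x * hilbertTransform (deriv Ω) x) 2 := by
    rw [hpt]; exact (eLpNorm_hilbertTransform_eq_of_memLp hxΩ' hpv').1
  exact ⟨hH1, hHd, hH2, fun y => hilbertTransform_neg_arg_of_odd hodd y, hH'c, hH'2, hxH'⟩

/-! ### §3 Sup bounds and smallness of `HΩ` at infinity -/

/-- `y ↦ y·f(y)` has derivative `f(x) + x·f′(x)`. [folklore] -/
theorem hasDerivAt_id_mul {f : ℝ → ℝ} {f' x : ℝ} (h : HasDerivAt f f' x) :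
    HasDerivAt (fun y => y * f y) (f x + x * f') x := by
  have h1 := (hasDerivAt_id x).mul h
  have hfun : (id * f : ℝ → ℝ) = fun y => y * f y := by funext y; simp only [Pi.mul_apply, id]
  rw [hfun] at h1
  exact h1.congr_deriv (by simp only [id]; ring)

/-- **Sup bounds on the energy class.** For `Ω ∈ C²` odd with `∫(L²+y²)Ω² < ∞`, `∫(L²+y²)Ω′² < ∞`: there are constants
with `(1+ξ²)Ω(ξ)² ≤ S`, `|HΩ(ξ)| ≤ B` and `|𝒰Ω(ξ)| = |∫₀^ξ HΩ| ≤ U₀` for every `ξ` (Agmon for `Ω`, `ξΩ`, `HΩ ∈ H¹`; the tree's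
velocity bound `SheetREnergyClass.abs_velocity_le_of_primitive`). [folklore] -/
theorem exists_bounds (hL : 0 < L) (hΩ : ContDiff ℝ 2 Ω) (hodd : ∀ y, Ω (-y) = -Ω y)
    (hw0 : Integrable fun y => (L ^ 2 + y ^ 2) * Ω y ^ 2)
    (hw1 : Integrable fun y => (L ^ 2 + y ^ 2) * deriv Ω y ^ 2) :
    ∃ S B U₀ : ℝ, (∀ x, (1 + x ^ 2) * Ω x ^ 2 ≤ S) ∧ (∀ x, |hilbertTransform Ω x| ≤ B) ∧
      ∀ x, |∫ s in (0 : ℝ)..x, hilbertTransform Ω s| ≤ U₀ := by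
  have hΩ1 : ContDiff ℝ 1 Ω := hΩ.of_le (by norm_num)
  obtain ⟨-, hΩ2, -, hΩ'2, hxΩ, hxΩ'⟩ := basic hL hΩ1 hw0 hw1
  obtain ⟨-, hHd, hH2, -, hH'c, hH'2, -⟩ := hilbert_basic hL hΩ hodd hw0 hw1
  have hΩ'c : Continuous (deriv Ω) := hΩ1.continuous_deriv le_rfl
  have hd1 : ∀ y, HasDerivAt Ω (deriv Ω y) y := fun y => ((hΩ1.differentiable one_ne_zero) y).hasDerivAt
  -- Agmon for `Ω`, `ξΩ`, `HΩ`
  have hA0 := sq_le_of_hasDerivAt hd1 hΩ'c hΩ2 hΩ'2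
  have hdx : ∀ y, HasDerivAt (fun s => s * Ω s) (Ω y + y * deriv Ω y) y := fun y => hasDerivAt_id_mul (hd1 y)
  have hx'2 : MemLp (fun y => Ω y + y * deriv Ω y) 2 := hΩ2.add hxΩ'
  have hA1 := sq_le_of_hasDerivAt hdx (hΩ.continuous.add (continuous_id.mul hΩ'c)) hxΩ hx'2
  have hA2 := sq_le_of_hasDerivAt hHd hH'c hH2 hH'2
  set S₀ : ℝ := 2 * ∫ y, |Ω y * deriv Ω y|
  set S₁ : ℝ := 2 * ∫ y, |y * Ω y * (Ω y + y * deriv Ω y)|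
  set S₂ : ℝ := 2 * ∫ y, |hilbertTransform Ω y * hilbertTransform (deriv Ω) y|
  refine ⟨S₀ + S₁, Real.sqrt S₂, Real.sqrt (π / (4 * L)) * Real.sqrt (∫ y, (L ^ 2 + y ^ 2) * Ω y ^ 2),
    fun x => ?_, fun x => ?_, fun x => ?_⟩
  · have h0 := hA0 x
    have h1 := hA1 x
    nlinarith
  · rw [← Real.sqrt_sq_eq_abs]
    exact Real.sqrt_le_sqrt (hA2 x)
  · exact SheetREnergyClass.abs_velocity_le_of_primitive hL (eq_add_integral_deriv hΩ1) hodd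
      hΩ'c.aestronglyMeasurable hw0 hw1 x

/-- **`HΩ(ξ) → 0` as `|ξ| → ∞`** on the odd energy class: for every `ε > 0` there is `R` with `|HΩ(ξ)| ≤ ε` for `|ξ| ≥ R`
(`(HΩ)²` and its derivative `2·HΩ·H[Ω′]` are integrable on `(0,∞)`; evenness of `HΩ` handles `ξ < 0`). [folklore] -/
theorem hilbert_small (hL : 0 < L) (hΩ : ContDiff ℝ 2 Ω) (hodd : ∀ y, Ω (-y) = -Ω y)
    (hw0 : Integrable fun y => (L ^ 2 + y ^ 2) * Ω y ^ 2)
    (hw1 : Integrable fun y => (L ^ 2 + y ^ 2) * deriv Ω y ^ 2) {ε : ℝ} (hε : 0 < ε) :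
    ∃ R : ℝ, ∀ x, R ≤ |x| → |hilbertTransform Ω x| ≤ ε := by
  obtain ⟨-, hHd, hH2, hHeven, -, hH'2, -⟩ := hilbert_basic hL hΩ hodd hw0 hw1
  have hderiv : ∀ x ∈ Ioi (0 : ℝ), HasDerivAt (fun y => hilbertTransform Ω y ^ 2)
      (2 * (hilbertTransform Ω x * hilbertTransform (deriv Ω) x)) x := fun x _ => by
    have h := (hHd x).mul (hHd x)
    have hfun : (hilbertTransform Ω * hilbertTransform Ω : ℝ → ℝ) = fun y => hilbertTransform Ω y ^ 2 := by
      funext y; simp only [Pi.mul_apply]; ring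
    rw [hfun] at h
    exact h.congr_deriv (by ring)
  have hfi : IntegrableOn (fun y => hilbertTransform Ω y ^ 2) (Ioi 0) := hH2.integrable_sq.integrableOn
  have hprod : Integrable (fun y => hilbertTransform Ω y * hilbertTransform (deriv Ω) y) :=
    hH2.integrable_mul hH'2
  have hf'i : IntegrableOn (fun y => 2 * (hilbertTransform Ω y * hilbertTransform (deriv Ω) y)) (Ioi 0) :=
    (hprod.const_mul 2).integrableOn
  have hT := MeasureTheory.tendsto_zero_of_hasDerivAt_of_integrableOn_Ioi hderiv hf'i hfi
  have hev : ∀ᶠ x in atTop, hilbertTransform Ω x ^ 2 < ε ^ 2 :=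
    hT.eventually (Iio_mem_nhds (by positivity))
  obtain ⟨R, hR⟩ := Filter.eventually_atTop.1 hev
  refine ⟨R, fun x hx => ?_⟩
  have hkey : hilbertTransform Ω (|x|) ^ 2 < ε ^ 2 := hR _ hx
  have hxe : hilbertTransform Ω x = hilbertTransform Ω (|x|) := by
    rcases le_or_gt 0 x with h0 | h0
    · rw [abs_of_nonneg h0]
    · rw [abs_of_neg h0, hHeven]
  rw [hxe]
  exact (abs_lt_of_sq_lt_sq hkey hε.le).le

/-! ### §4 `C³` regularity and the differentiated equation -/

/-- The strong equation solved for `Ω″` (`ν ≠ 0`): `Ω″ = (Ω + ½ξΩ′ + a𝒰Ω·Ω′ − HΩ·Ω)/ν`. [folklore] -/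
theorem deriv_two_eq (hν : ν ≠ 0)
    (hG : ∀ X, Ω X + 1 / 2 * X * deriv Ω X + a * (∫ s in (0 : ℝ)..X, hilbertTransform Ω s) * deriv Ω X
      - hilbertTransform Ω X * Ω X - ν * iteratedDeriv 2 Ω X = 0) (X : ℝ) :
    deriv (deriv Ω) X = (Ω X + 1 / 2 * X * deriv Ω X
      + a * (∫ s in (0 : ℝ)..X, hilbertTransform Ω s) * deriv Ω X - hilbertTransform Ω X * Ω X) / ν := by
  have h := hG X
  rw [iteratedDeriv_succ, iteratedDeriv_one] at h
  field_simp
  linarith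

/-- The velocity `𝒰Ω = ∫₀HΩ` is `C¹` with derivative `HΩ` when `HΩ` is continuous. [folklore] -/
theorem velocity_hasDerivAt {h : ℝ → ℝ} (hc : Continuous h) (X : ℝ) :
    HasDerivAt (fun Y => ∫ s in (0 : ℝ)..Y, h s) (h X) X :=
  (hc.integral_hasStrictDerivAt 0 X).hasDerivAt

/-- `𝒰Ω ∈ C¹` when `HΩ` is continuous. [folklore] -/
theorem velocity_contDiff_one {h : ℝ → ℝ} (hc : Continuous h) :
    ContDiff ℝ 1 (fun Y => ∫ s in (0 : ℝ)..Y, h s) := by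
  refine contDiff_one_iff_deriv.2 ⟨fun X => (velocity_hasDerivAt hc X).differentiableAt, ?_⟩
  have : deriv (fun Y => ∫ s in (0 : ℝ)..Y, h s) = h := funext fun X => (velocity_hasDerivAt hc X).deriv
  rw [this]; exact hc

/-- **`Ω ∈ C³`.** An energy-class `C²` strong zero of the profile map (`ν ≠ 0`) is `C³`: `νΩ″ = Ω + ½ξΩ′ + a𝒰Ω·Ω′ − HΩ·Ω`
is `C¹` because `HΩ ∈ C¹` (`SheetRHilbertDerivL1.contDiff_one_hilbertTransform`, using only `Ω, Ω′ ∈ L¹`). MODEL statement;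
not NS. [folklore] -/
theorem contDiff_three (hL : 0 < L) (hν : ν ≠ 0) (hΩ : ContDiff ℝ 2 Ω)
    (hw0 : Integrable fun y => (L ^ 2 + y ^ 2) * Ω y ^ 2)
    (hw1 : Integrable fun y => (L ^ 2 + y ^ 2) * deriv Ω y ^ 2)
    (hG : ∀ X, Ω X + 1 / 2 * X * deriv Ω X + a * (∫ s in (0 : ℝ)..X, hilbertTransform Ω s) * deriv Ω X
      - hilbertTransform Ω X * Ω X - ν * iteratedDeriv 2 Ω X = 0) :
    ContDiff ℝ 3 Ω := by
  have hΩ1 : ContDiff ℝ 1 Ω := hΩ.of_le (by norm_num)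
  obtain ⟨hΩi, -, hΩ'i, -, -, -⟩ := basic hL hΩ1 hw0 hw1
  have hΩ'1 : ContDiff ℝ 1 (deriv Ω) := (contDiff_succ_iff_deriv.1 (hΩ : ContDiff ℝ (1 + 1) Ω)).2.2
  have hH1 : ContDiff ℝ 1 (hilbertTransform Ω) := contDiff_one_hilbertTransform hΩ hΩi hΩ'i
  have hU1 : ContDiff ℝ 1 (fun Y => ∫ s in (0 : ℝ)..Y, hilbertTransform Ω s) := velocity_contDiff_one hH1.continuous
  have hF1 : ContDiff ℝ 1 (fun X => (Ω X + 1 / 2 * X * deriv Ω X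
      + a * (∫ s in (0 : ℝ)..X, hilbertTransform Ω s) * deriv Ω X - hilbertTransform Ω X * Ω X) / ν) :=
    (((hΩ1.add ((contDiff_const.mul contDiff_id).mul hΩ'1)).add ((contDiff_const.mul hU1).mul hΩ'1)).sub
      (hH1.mul hΩ1)).div_const ν
  have hd2 : deriv (deriv Ω) = fun X => (Ω X + 1 / 2 * X * deriv Ω X
      + a * (∫ s in (0 : ℝ)..X, hilbertTransform Ω s) * deriv Ω X - hilbertTransform Ω X * Ω X) / ν :=
    funext (deriv_two_eq hν hG)
  have hd : Differentiable ℝ Ω := hΩ.differentiable (by norm_num)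
  have hd' : Differentiable ℝ (deriv Ω) := hΩ'1.differentiable one_ne_zero
  have h2 : ContDiff ℝ 2 (deriv Ω) := by
    show ContDiff ℝ (1 + 1) (deriv Ω)
    refine contDiff_succ_iff_deriv.2 ⟨hd', fun h => ?_, by rw [hd2]; exact hF1⟩
    simp at h
  show ContDiff ℝ (2 + 1) Ω
  refine contDiff_succ_iff_deriv.2 ⟨hd, fun h => ?_, h2⟩
  simp at h

/-- **The differentiated profile equation.** For an energy-class `C²` strong zero (`ν ≠ 0`), at every `ξ`:
`ν·Ω‴ = (½ξ + a𝒰Ω)·Ω″ + (3/2 + (a−1)HΩ)·Ω′ − H[Ω′]·Ω` — i.e. `Ψ = Ω′` solves the 1-D similarity ODE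
`νΨ″ = (½ξ + b)Ψ′ + (κ + c)Ψ + g` with `κ = 3/2`, `b = a𝒰Ω`, `c = (a−1)HΩ`, `g = −H[Ω′]Ω` (the form of
`SheetRWeightedGain.weighted_gain`). Uses `(HΩ)′ = H[Ω′]` and `(𝒰Ω)′ = HΩ`. MODEL statement; not NS. [folklore] -/
theorem deriv_three_eq (hL : 0 < L) (hν : ν ≠ 0) (hΩ : ContDiff ℝ 2 Ω) (hodd : ∀ y, Ω (-y) = -Ω y)
    (hw0 : Integrable fun y => (L ^ 2 + y ^ 2) * Ω y ^ 2)
    (hw1 : Integrable fun y => (L ^ 2 + y ^ 2) * deriv Ω y ^ 2)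
    (hG : ∀ X, Ω X + 1 / 2 * X * deriv Ω X + a * (∫ s in (0 : ℝ)..X, hilbertTransform Ω s) * deriv Ω X
      - hilbertTransform Ω X * Ω X - ν * iteratedDeriv 2 Ω X = 0) (ξ : ℝ) :
    ν * deriv (deriv (deriv Ω)) ξ =
      (ξ / 2 + a * ∫ s in (0 : ℝ)..ξ, hilbertTransform Ω s) * deriv (deriv Ω) ξ
        + (3 / 2 + (a - 1) * hilbertTransform Ω ξ) * deriv Ω ξ
        + -(hilbertTransform (deriv Ω) ξ * Ω ξ) := by
  have hΩ1 : ContDiff ℝ 1 Ω := hΩ.of_le (by norm_num)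
  obtain ⟨hH1, hHd, -, -, -, -, -⟩ := hilbert_basic hL hΩ hodd hw0 hw1
  have hΩ'1 : ContDiff ℝ 1 (deriv Ω) := (contDiff_succ_iff_deriv.1 (hΩ : ContDiff ℝ (1 + 1) Ω)).2.2
  have hd1 : ∀ y, HasDerivAt Ω (deriv Ω y) y := fun y => ((hΩ1.differentiable one_ne_zero) y).hasDerivAt
  have hd2 : ∀ y, HasDerivAt (deriv Ω) (deriv (deriv Ω) y) y :=
    fun y => ((hΩ'1.differentiable one_ne_zero) y).hasDerivAt
  have hUd : ∀ X, HasDerivAt (fun Y => ∫ s in (0 : ℝ)..Y, hilbertTransform Ω s) (hilbertTransform Ω X) X :=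
    velocity_hasDerivAt hH1.continuous
  -- derivative of `F = Ω + ½ξΩ′ + a𝒰ΩΩ′ − HΩΩ` at `ξ`
  have hlin : HasDerivAt (fun y : ℝ => 1 / 2 * y) (1 / 2) ξ := by
    simpa using (hasDerivAt_id ξ).const_mul (1 / 2 : ℝ)
  have h := (((hd1 ξ).add (hlin.mul (hd2 ξ))).add (((hUd ξ).mul (hd2 ξ)).const_mul a)).sub
    ((hHd ξ).mul (hd1 ξ))
  have hfun : (Ω + (fun y : ℝ => 1 / 2 * y) * deriv Ω
        + (fun y => a * ((fun Y => ∫ s in (0 : ℝ)..Y, hilbertTransform Ω s) * deriv Ω) y)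
        - hilbertTransform Ω * Ω : ℝ → ℝ) = fun X => Ω X + 1 / 2 * X * deriv Ω X
          + a * (∫ s in (0 : ℝ)..X, hilbertTransform Ω s) * deriv Ω X - hilbertTransform Ω X * Ω X := by
    funext Y
    simp only [Pi.add_apply, Pi.mul_apply, Pi.sub_apply]
    ring
  rw [hfun] at h
  have hF := h.div_const ν
  -- `Ω″ = F/ν` near `ξ`, so `Ω‴(ξ) = F′(ξ)/ν`
  have hF' := hF.congr_of_eventuallyEq (Eventually.of_forall fun X => deriv_two_eq hν hG X)
  rw [hF'.deriv]
  field_simp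
  ring

/-! ### §5 `Ω″ ∈ L²` (level-0 start of the weighted gain) -/

/-- **`Ω″ ∈ L²`** for an odd energy-class `C²` strong zero (`ν ≠ 0`): `νΩ″ = Ω + ½ξΩ′ + a𝒰Ω·Ω′ − HΩ·Ω` with
`Ω, ξΩ′ ∈ L²` and `𝒰Ω`, `HΩ` bounded. MODEL statement; not NS. [folklore] -/
theorem memLp_two_deriv_two (hL : 0 < L) (hν : ν ≠ 0) (hΩ : ContDiff ℝ 2 Ω) (hodd : ∀ y, Ω (-y) = -Ω y)
    (hw0 : Integrable fun y => (L ^ 2 + y ^ 2) * Ω y ^ 2)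
    (hw1 : Integrable fun y => (L ^ 2 + y ^ 2) * deriv Ω y ^ 2)
    (hG : ∀ X, Ω X + 1 / 2 * X * deriv Ω X + a * (∫ s in (0 : ℝ)..X, hilbertTransform Ω s) * deriv Ω X
      - hilbertTransform Ω X * Ω X - ν * iteratedDeriv 2 Ω X = 0) :
    MemLp (deriv (deriv Ω)) 2 := by
  have hΩ1 : ContDiff ℝ 1 Ω := hΩ.of_le (by norm_num)
  obtain ⟨-, hΩ2, -, hΩ'2, -, hxΩ'⟩ := basic hL hΩ1 hw0 hw1
  obtain ⟨hH1, -, -, -, -, -, -⟩ := hilbert_basic hL hΩ hodd hw0 hw1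
  obtain ⟨S, B, U₀, -, hB, hU⟩ := exists_bounds hL hΩ hodd hw0 hw1
  have hd2f : deriv (deriv Ω) = fun X => (Ω X + 1 / 2 * X * deriv Ω X
      + a * (∫ s in (0 : ℝ)..X, hilbertTransform Ω s) * deriv Ω X - hilbertTransform Ω X * Ω X) / ν :=
    funext (deriv_two_eq hν hG)
  have hUc : Continuous (fun Y => ∫ s in (0 : ℝ)..Y, hilbertTransform Ω s) :=
    (velocity_contDiff_one hH1.continuous).continuous
  have m1 : MemLp (fun X : ℝ => 1 / 2 * (X * deriv Ω X)) 2 := hxΩ'.const_mul _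
  have m2 : MemLp (fun X => (∫ s in (0 : ℝ)..X, hilbertTransform Ω s) * deriv Ω X) 2 :=
    memLp_two_bdd_mul hUc hU hΩ'2
  have m3 : MemLp (fun X => hilbertTransform Ω X * Ω X) 2 := memLp_two_bdd_mul hH1.continuous hB hΩ2
  have m := ((((hΩ2.add m1).add (m2.const_mul a)).sub m3).const_mul (1 / ν))
  rw [hd2f]
  refine m.ae_eq (Eventually.of_forall fun X => ?_)
  simp only [Pi.add_apply, Pi.sub_apply]
  ring

end SheetRProfileRegularity
end Summit.NavierStokesRegularity.OSWSelfSimilar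

end
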